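/-
COR-CM (cells pub-hodgecm / pub-hodgecm2, stage 2 of the Hodge ladder) — item (vi) S2 «along» lane, WORLD-FREE hM SIDE, step (W2) of the
recipe HOME/INBOX 2026-08-24 (prove-7 g1 l.13149; referee preference d2bridge-ref G33 §5 l.13123; pin-2 l.13122/l.13157; own-htheta g11 l.13168).
The landed display ✔ `Item6SupplyPinnedAssemblyAlongHoldsRestOneBuiltEpi(D1).lean` (pointer #7) shows [Liu2021, Thm. 4.18] AS PRINTED (`hLiu`) at the
twisted §4.2 datum with the face's own Weil carriers; the junction consumes it ONLY through ✔ `Thm418Invariants.exists_homK_ne_zero_of_irreducible_smooth`,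
i.e. as «`Hom_E(A_K, A_μ)_ℚ ≠ 0` for small `K`».  This file re-runs the SAME flattened junction (§0 of `…BuiltEpi.lean`) from that CONSEQUENCE (`hHom`),
displayed CARRIER-FREE (no Weil module, no Hecke translate, no character enters the hM side any more), through prove-7's world-free along-junction
✔∕⏳ `Model.faceSupply_of_homNeZero_pinned_isog_along`.  Seat prover-pub-hodgecm-own-htheta-g11-0 (content owner of the `…Along*` family).
THEOREMS ONLY (kernel lane): no definition, no instance, no `variable`, no notation; nothing landed is edited or restated.  FRAMING: HC_CM is NOT proved;
`h`, `hHom`, `h21`, `hM` are displayed hypotheses, none inhabited here.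
-/
import Summits.HodgeConjecture.CorCM.B01.Transposition.Item6SupplyPinnedAssemblyAlongHoldsRestOneBuiltEpi
import Summits.HodgeConjecture.CorCM.D2Bridge.FaceSupplyOfHomNeZeroAlong
import HarnessLib

set_option autoImplicit false

/-!
# B01-S and the (β)-free END display of the hM side from «`Hom_E(Alb(X_K), A_μ)_ℚ ≠ 0`» — world-free, carrier-free (W2)

§1 `Model.faceSupply_of_homNeZero_along_conj_holds_restOne_epi` — B01-S on `U = picardCMUniverse hHD hI h₁ h₃` from the record `h`
   ([Deligne1979] canonical models), Casselman `h21` ([Shimura1998] Thm. 21.4, for `𝒜(μ) ≠ ∅`) and the ONE Liu-side input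
   `hHom` : for every Galois CM `F` (`6 ≤ [F:ℚ]`), CM type `Φ ∋ ι₁`, `V`, and every object `D_μ ∈ 𝒜(μ(Φ,ι₁))` presented at `ι₁`
   (pin-2's de Rham polarisation datum `Def45.PolDR ι₁ _ (Def45.RMuForm ι₁ _)`): `Hom_F(Alb((sec42DataOf h isoOf F ι₁ V Φ).X_K), A_{D_μ})_ℚ ≠ 0`
   for all sufficiently small open compact `K` — [Liu2021, Thm. 4.18 (1) (FJcycle.tex l. 2239) + Rem. 4.17 + the main isomorphism with App. D
   Lem. D.1 (1)] as a printed CONSEQUENCE, true at the tree's datum under either pairing of the Weil side (d2bridge-ref G33 §5 (2)).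
   Proof = `…BuiltEpi` §0's, at the rest `restOne …` with INERT Weil∕Ω fields (the homNeZero junction reads `Obj ∕ Aμ ∕ μ ∕ Φ_μ ∕ HomK ∕ G` only —
   `Obj = ObjOne …`, `HomK K D = HomQ (levelOf K) (AμOne … D)`, `G = C.G` by `rfl`), reach from TEAM hComp's ✔ `Model.pinReachEpi_closed`,
   the CM half verbatim (`exists_isogeny_isCMTypeRealisation_baseChange_of_det45` at `σ := ῑ₁`).
§2 `Model.hc_cm_of_homNeZero_along_conj_holds_restOne_epi_meeting_rec` — meeting form on `U_rec`: END DISPLAY 3 NAMED {h; hHom; h21} + hM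
   (pointer #7's {h; hLiu; h21; hD1} + hM with the Thm-4.18 iso and Lem. D.1 (1) REPLACED by their consumed consequence).
HC_CM is NOT proved.  References as in `…BuiltEpi.lean`; Y. Liu, Camb. J. Math. 9 (2021), Thm. 4.18 (1), Rem. 4.17, Def. 4.5 (2).
-/

noncomputable section

open scoped TensorProduct InnerProductSpace Kronecker

namespace Summit.HodgeConjecture.CorCM.Model

open CategoryTheory CategoryTheory.Limits AlgebraicGeometry NumberField
open Literature.AlgebraicGeometry.Motives
open Literature.AlgebraicGeometry.HodgeTheory
open Literature.AlgebraicGeometry.ShimuraVarieties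
open Literature.AlgebraicGeometry.ShimuraVarieties.UnitaryCanonicalModel
open Literature.AlgebraicGeometry.ComplexMultiplication (IsCMTypeRealisation)
open Literature.NumberTheory.ComplexMultiplication
open Literature.NumberTheory.Automorphic
open Literature.NumberTheory.Automorphic.IdeleClassGroup
open Literature.NumberTheory.Automorphic.PicardCM
open Literature.NumberTheory.Automorphic.Liu2021
open Literature.NumberTheory.Automorphic.Liu2021.AppendixC
open Literature.NumberTheory.Automorphic.Liu2021.AppendixC.RestOne
open Literature.NumberTheory.Automorphic.Liu2021.Def411WeilCarriers (JW TW isSymm_TW isUnit_det_TW JW_eq)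
open Literature.NumberTheory.GelbartRogawski1991 Literature.NumberTheory.GelbartRogawski1991.UnitaryDualPair
open Literature.NumberTheory.Weil1964 Literature.RepresentationTheory
open Summit.HodgeConjecture.CorCM.Transposition

/-! ## §1  B01-S from «Hom ≠ 0» at the one-object rest, reach WITHOUT the Albanese cite -/

/-- **B01-S from the printed consequence «`Hom_E(Alb(X_K), A_μ)_ℚ ≠ 0` for small `K`» of [Liu2021, Thm. 4.18 (1)]** (`U = picardCMUniverse hHD hI h₁ h₃`),
world-free and carrier-free: the flattened along-junction of ✔ `faceSupply_of_thm418AsPrinted_along_conj_holds_restOne_epi` re-run through prove-7's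
`faceSupply_of_homNeZero_pinned_isog_along` at `D := toThm418Data (sec42DataOf h isoOf …) (restOne … ι₁ μ(Φ,ι₁) …)` whose Weil∕Ω fields are inert
(never read), pin `A_μ ⊗_{F,ῑ₁} ℂ`, reach `pinReachEpi_closed`, `𝒜(μ) ≠ ∅` from Casselman `h21` at pin-2's de Rham form, the CM half at `σ := ῑ₁` verbatim.
Displayed: `h` ([Deligne1979] 2.1.2∕2.2.5 record), `hHom` (Thm. 4.18 (1) consequence), `h21` ([Shimura1998] Thm. 21.4).  HC_CM is NOT proved; nothing is inhabited here.
[cite: Liu2021, Thm. 4.18 (1) (FJcycle.tex l. 2239), Rem. 4.17 (l. 2226–2228), Def. 4.5 (2) (l. 1944–1958), §4.2 l. 2053–2074 and Prop. C.5 (l. 4627–4637)]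
[cite: Shimura1998, §21.4 Thm. 21.4] [cite: Deligne1979ShimuraVarieties, §2.1.2, 2.2.5 and Cor. 2.7.21] -/
theorem faceSupply_of_homNeZero_along_conj_holds_restOne_epi
    (hHD : exists_isReal_hodgeModel) (hI : hodgePQ_independent_of_hodgeModel)
    (h₁ : BallQuotientUniformised) (h₃ : CMAbelianVarietyRealised)
    (h : exists_recordSystem)
    (hHom : ∀ (F : CMField) [IsGalois ℚ F], 6 ≤ Module.finrank ℚ F → ∀ (Φ : CMType F) (ι₁ : F →+* ℂ), ι₁ ∈ Φ.1 →
      ∀ (V : HermSpace3 F ι₁)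
        (Dμ : ObjOne (AlgHom.id ℚ F) ι₁ (isConjugateSymplectic_muOfInvType ι₁ Φ) (hasWeight_one_muOfInvType ι₁ Φ)
          (Def45.Carriers.ofPolDR (muOfInvType ι₁ Φ) (Def45.PolDR ι₁ (isConjugateSymplectic_muOfInvType ι₁ Φ) (Def45.RMuForm ι₁ (isConjugateSymplectic_muOfInvType ι₁ Φ))))),
        ∃ K₀ : Subgroup (sec42DataOf h isoOf F ι₁ V Φ).G, IsOpenCompact K₀ ∧
          ∀ K : Subgroup (sec42DataOf h isoOf F ι₁ V Φ).G, IsOpenCompact K → K ≤ K₀ →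
            ∃ φ : (sec42DataOf h isoOf F ι₁ V Φ).HomQ ((sec42DataOf h isoOf F ι₁ V Φ).levelOf K)
              (AμOne (AlgHom.id ℚ F) ι₁ (isConjugateSymplectic_muOfInvType ι₁ Φ) (hasWeight_one_muOfInvType ι₁ Φ)
                (Def45.Carriers.ofPolDR (muOfInvType ι₁ Φ) (Def45.PolDR ι₁ (isConjugateSymplectic_muOfInvType ι₁ Φ) (Def45.RMuForm ι₁ (isConjugateSymplectic_muOfInvType ι₁ Φ)))) Dμ),
              φ ≠ 0)
    (h21 : shimura1998_thm21_4_casselman) :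
    (picardCMUniverse hHD hI h₁ h₃).FaceSupply := by
  classical
  -- THE DATUM fed to the world-free junction: on the Galois branch the one-object rest at `μ(Φ,ι₁)` presented at `ι₁` with pin-2's de Rham
  -- polarisation datum and INERT Weil∕Ω fields (`PUnit` carriers, trivial actions — the junction reads none of them); an inert rest off the
  -- Galois branch (never read: every hypothesis of the junction is guarded by `IsGalois ℚ F`)
  let R : ∀ (F : CMField) (ι₁ : F →+* ℂ) (V : HermSpace3 F ι₁) (Φ : CMType F), Thm418Rest (sec42DataOf h isoOf F ι₁ V Φ) := fun F ι₁ V Φ =>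
    if hG : IsGalois ℚ F then
      restOne (sec42DataOf h isoOf F ι₁ V Φ) (AlgHom.id ℚ F) ι₁ (isConjugateSymplectic_muOfInvType ι₁ Φ) (hasWeight_one_muOfInvType ι₁ Φ)
        (Def45.Carriers.ofPolDR (muOfInvType ι₁ Φ) (Def45.PolDR ι₁ (isConjugateSymplectic_muOfInvType ι₁ Φ) (Def45.RMuForm ι₁ (isConjugateSymplectic_muOfInvType ι₁ Φ))))
        PUnit (fun _ => PUnit.unit) PUnit (fun _ _ => PUnit) (fun _ _ => 1) 1
    else
      { Eps := PUnit
        epsOf := fun _ => PUnit.unit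
        Chi := PEmpty
        μ := (exists_isConjugateSymplectic_hasCMType (L := F) Φ).choose
        isConjugateSymplectic := (exists_isConjugateSymplectic_hasCMType (L := F) Φ).choose_spec.1
        hasWeight_one := (exists_isConjugateSymplectic_hasCMType (L := F) Φ).choose_spec.2.1
        Obj := PEmpty
        Aμ := fun D => D.elim
        omega := fun _ χ => χ.elim
        instAddCommGroupOmega := fun _ χ => χ.elim
        instModuleOmega := fun _ χ => χ.elim
        rho := fun _ χ => χ.elim
        Ω := PUnit
        rhoΩ := 1
        res := fun _ D => D.elim
        res_pull := fun _ D => D.elim }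
  have hR : ∀ (F : CMField) [hG : IsGalois ℚ F] (ι₁ : F →+* ℂ) (V : HermSpace3 F ι₁) (Φ : CMType F), R F ι₁ V Φ =
      restOne (sec42DataOf h isoOf F ι₁ V Φ) (AlgHom.id ℚ F) ι₁ (isConjugateSymplectic_muOfInvType ι₁ Φ) (hasWeight_one_muOfInvType ι₁ Φ)
        (Def45.Carriers.ofPolDR (muOfInvType ι₁ Φ) (Def45.PolDR ι₁ (isConjugateSymplectic_muOfInvType ι₁ Φ) (Def45.RMuForm ι₁ (isConjugateSymplectic_muOfInvType ι₁ Φ))))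
        PUnit (fun _ => PUnit.unit) PUnit (fun _ _ => PUnit) (fun _ _ => 1) 1 :=
    fun F hG ι₁ V Φ => dif_pos hG
  -- prove-7's world-free along-junction, pin `A_μ ⊗_{F,ῑ₁} ℂ`, reach from TEAM hComp's hA-free closed term `pinReachEpi_closed`
  refine faceSupply_of_homNeZero_pinned_isog_along hHD hI h₁ h₃
    (fun F ι₁ V Φ => toThm418Data (sec42DataOf h isoOf F ι₁ V Φ) (R F ι₁ V Φ)) (fun _ ι₁ _ _ => (starRingEnd ℂ).comp ι₁)
    (fun F ι₁ V Φ Dμ => letI := ((starRingEnd ℂ).comp ι₁).toAlgebra; ((R F ι₁ V Φ).Aμ Dμ).baseChange ℂ)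
    ?_ ?_ ?_ ?_ (pinReachEpi_closed h₁ h₃ h isoOf (sec42DataOf h isoOf) R)
  -- «Hom ≠ 0»: the displayed `hHom`, read at the rest (`Obj = ObjOne …`, `G = C.G`, `HomK K D = HomQ (levelOf K) (AμOne … D)` by `rfl`)
  · intro F hG h6 Φ ι₁ hι V
    rw [hR]
    exact fun Dμ => hHom F h6 Φ ι₁ hι V Dμ
  -- Prop. 4.6 (1) «𝒜(μ) ≠ ∅» from Casselman `h21` at the de Rham form, through `nonempty_obj_restOne_iff`
  · intro F hG h6 Φ ι₁ hι V
    rw [hR]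
    exact (nonempty_obj_restOne_iff (sec42DataOf h isoOf F ι₁ V Φ) (AlgHom.id ℚ F) ι₁ (isConjugateSymplectic_muOfInvType ι₁ Φ)
      (hasWeight_one_muOfInvType ι₁ Φ)
      (Def45.Carriers.ofPolDR (muOfInvType ι₁ Φ) (Def45.PolDR ι₁ (isConjugateSymplectic_muOfInvType ι₁ Φ) (Def45.RMuForm ι₁ (isConjugateSymplectic_muOfInvType ι₁ Φ))))
      PUnit (fun _ => PUnit.unit) PUnit (fun _ _ => PUnit) (fun _ _ => 1) 1).mpr
      (Def45.nonempty_cmDatum_polarised_of_casselman' ι₁ (isConjugateSymplectic_muOfInvType ι₁ Φ)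
        (hasWeight_one_muOfInvType ι₁ Φ) h21 (Def45.RMuForm ι₁ (isConjugateSymplectic_muOfInvType ι₁ Φ))
        (fun A i => Def45.rMuForm_nonempty ι₁ (isConjugateSymplectic_muOfInvType ι₁ Φ) A i))
  -- THE CHOICE `Φ_μ = Φ^{*ι₁}` read at `ῑ₁` (own-htheta's theorem for `μ := μ(Φ, ι₁)`, through `isInverse_starRingEnd_comp_iff`)
  · intro F hG h6 Φ ι₁ hι V
    rw [hR]
    exact (Transposition.isInverse_starRingEnd_comp_iff ι₁ Φ _).mpr fun g =>
      thm418Data_comp_mem_cmType_iff_of_mu_eq _ ι₁ Φ rfl g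
  -- THE CM HALF at `σ := ῑ₁` with the projections of the chosen Def. 4.5 (2) datum (verbatim from `…BuiltEpi` §0)
  · intro F hG h6 Φ ι₁ hι V
    rw [hR]
    intro Dμ incl hincl
    exact exists_isogeny_isCMTypeRealisation_baseChange_of_det45 cotangent_hodge10_comparison_holds
      (fun _ _ L _ _ _ u => AbelianVariety.det_cotangentMap_baseChange L u)
      ((starRingEnd ℂ).comp ι₁) (isConjugateSymplectic_muOfInvType ι₁ Φ)
      (AμOne (AlgHom.id ℚ F) ι₁ (isConjugateSymplectic_muOfInvType ι₁ Φ) (hasWeight_one_muOfInvType ι₁ Φ)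
        (Def45.Carriers.ofPolDR (muOfInvType ι₁ Φ) (Def45.PolDR ι₁ (isConjugateSymplectic_muOfInvType ι₁ Φ) (Def45.RMuForm ι₁ (isConjugateSymplectic_muOfInvType ι₁ Φ)))) Dμ)
      (iOne (AlgHom.id ℚ F) ι₁ (isConjugateSymplectic_muOfInvType ι₁ Φ) (hasWeight_one_muOfInvType ι₁ Φ)
        (Def45.Carriers.ofPolDR (muOfInvType ι₁ Φ) (Def45.PolDR ι₁ (isConjugateSymplectic_muOfInvType ι₁ Φ) (Def45.RMuForm ι₁ (isConjugateSymplectic_muOfInvType ι₁ Φ)))) Dμ)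
      (hdimOne (AlgHom.id ℚ F) ι₁ (isConjugateSymplectic_muOfInvType ι₁ Φ) (hasWeight_one_muOfInvType ι₁ Φ)
        (Def45.Carriers.ofPolDR (muOfInvType ι₁ Φ) (Def45.PolDR ι₁ (isConjugateSymplectic_muOfInvType ι₁ Φ) (Def45.RMuForm ι₁ (isConjugateSymplectic_muOfInvType ι₁ Φ)))) Dμ)
      (fun x M f hM hx => by
        rw [Def45.eta_starRingEnd_comp_apply]
        exact hdet45One (AlgHom.id ℚ F) ι₁ (isConjugateSymplectic_muOfInvType ι₁ Φ) (hasWeight_one_muOfInvType ι₁ Φ)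
          (Def45.Carriers.ofPolDR (muOfInvType ι₁ Φ) (Def45.PolDR ι₁ (isConjugateSymplectic_muOfInvType ι₁ Φ) (Def45.RMuForm ι₁ (isConjugateSymplectic_muOfInvType ι₁ Φ))))
          Dμ x M f hM hx)
      incl hincl

/-! ## §2  THE WORLD-FREE END DISPLAY OF THE hM SIDE, MEETING FORM, on the universe of record — 3 NAMED + hM -/

section MeetingFormHomNeZero

open MeasureTheory
open Prior.Perl34File (Perl34.IsolationSetting)
open Prior.Perl34File.Perl34

/-- **END DISPLAY, (β)-FREE MEETING FORM, on the universe OF RECORD, world-free hM side** (`let U := U_rec`): §1 composed BY NAME with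
✔ `hc_cm_of_supply_of_settingMeetSat_embOf` at the four `_holds` data and `deligneMilne1982_Thm_6_20_full_holds`, exactly as `…BuiltEpi` §2.
Displayed hypotheses = cites {`h` [Deligne1979], `hHom` = [Liu2021] Thm. 4.18 (1)'s printed consequence «`Hom_E(Alb X_K, A_μ)_ℚ ≠ 0` for small `K`»
(carrier-free), `h21` [Shimura1998] Thm. 21.4} + the theta-side meeting binder `hM` (b01-x2's text VERBATIM at `U_rec`) = 3 NAMED + hM.
HC_CM is NOT proved: no hypothesis is inhabited here.
[cite: Liu2021, Thm. 4.18 (1) (FJcycle.tex l. 2239), Rem. 4.17 (l. 2226–2228), Def. 4.5 (2), §4.2 l. 2053–2074] [cite: Shimura1998, §21.4 Thm. 21.4]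
[cite: Deligne1979ShimuraVarieties, §2.1.2, 2.2.5 and Cor. 2.7.21] -/
theorem hc_cm_of_homNeZero_along_conj_holds_restOne_epi_meeting_rec
    (h : exists_recordSystem)
    (hHom : ∀ (F : CMField) [IsGalois ℚ F], 6 ≤ Module.finrank ℚ F → ∀ (Φ : CMType F) (ι₁ : F →+* ℂ), ι₁ ∈ Φ.1 →
      ∀ (V : HermSpace3 F ι₁)
        (Dμ : ObjOne (AlgHom.id ℚ F) ι₁ (isConjugateSymplectic_muOfInvType ι₁ Φ) (hasWeight_one_muOfInvType ι₁ Φ)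
          (Def45.Carriers.ofPolDR (muOfInvType ι₁ Φ) (Def45.PolDR ι₁ (isConjugateSymplectic_muOfInvType ι₁ Φ) (Def45.RMuForm ι₁ (isConjugateSymplectic_muOfInvType ι₁ Φ))))),
        ∃ K₀ : Subgroup (sec42DataOf h isoOf F ι₁ V Φ).G, IsOpenCompact K₀ ∧
          ∀ K : Subgroup (sec42DataOf h isoOf F ι₁ V Φ).G, IsOpenCompact K → K ≤ K₀ →
            ∃ φ : (sec42DataOf h isoOf F ι₁ V Φ).HomQ ((sec42DataOf h isoOf F ι₁ V Φ).levelOf K)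
              (AμOne (AlgHom.id ℚ F) ι₁ (isConjugateSymplectic_muOfInvType ι₁ Φ) (hasWeight_one_muOfInvType ι₁ Φ)
                (Def45.Carriers.ofPolDR (muOfInvType ι₁ Φ) (Def45.PolDR ι₁ (isConjugateSymplectic_muOfInvType ι₁ Φ) (Def45.RMuForm ι₁ (isConjugateSymplectic_muOfInvType ι₁ Φ)))) Dμ),
              φ ≠ 0)
    (h21 : shimura1998_thm21_4_casselman) :
    let U := picardCMUniverse exists_isReal_hodgeModel_holds hodgePQ_independent_of_hodgeModel_holds
      BallQuotient.ballQuotientUniformised_holds cmAbelianVarietyRealised_holds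
    let hU := ballQuotientUniformisedDatum_of BallQuotient.ballQuotientUniformised_holds
    (∀ (F : CMField), IsGalois ℚ F → 6 ≤ Module.finrank ℚ F → ∀ (f : Face F) (ι₁ : F →+* ℂ), f.Admissible ι₁ →
      ∀ V : HermSpace3 F ι₁,
      ∃ (H CG G SK SigIdx SigIdxG : Type) (_ : NormedAddCommGroup H) (_ : InnerProductSpace ℂ H) (_ : CompleteSpace H)
        (_ : NormedAddCommGroup CG) (_ : NormedSpace ℂ CG) (_ : Group G) (_ : TopologicalSpace G) (_ : TopologicalSpace SK)
        (S : Perl34.IsolationSetting H (Lp ℂ 2 V.autMeasure) CG G SK SigIdx SigIdxG),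
        (∀ (Γ : Level V) (ω₁ ω₂ : U.CohC (U.pms F ι₁ V Γ) 1),
          ω₁ ∈ U.Uiso Γ F (f.psi 0) ι₁ → ω₂ ∈ U.Uiso Γ F (f.psi 1) ι₁ →
            embOf exists_isReal_hodgeModel_holds hodgePQ_independent_of_hodgeModel_holds hU cmAbelianVarietyRealised_holds Γ
                (U.cup2C (U.pms F ι₁ V Γ) 1 ω₁ ω₂) ≠ 0 →
              ∃ u ∈ S.t12.S12,
                ⟪embOf exists_isReal_hodgeModel_holds hodgePQ_independent_of_hodgeModel_holds hU cmAbelianVarietyRealised_holds Γ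
                    (U.cup2C (U.pms F ι₁ V Γ) 1 ω₁ ω₂), u⟫_ℂ ≠ 0) ∧
        (∀ χ : S.t34.X, S.t34.allowed χ → ∀ (Φ : SK) (Γ₁ : Level V)
          (ω₁ ω₂ : U.CohC (U.pms F ι₁ V Γ₁) 1),
          ω₁ ∈ U.Uiso Γ₁ F (f.psi 0) ι₁ →
          ω₂ ∈ U.Uiso Γ₁ F (f.psi 1) ι₁ →
            ⟪embOf exists_isReal_hodgeModel_holds hodgePQ_independent_of_hodgeModel_holds hU cmAbelianVarietyRealised_holds Γ₁
                (U.cup2C (U.pms F ι₁ V Γ₁) 1 ω₁ ω₂),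
              S.t34.ϑ χ Φ⟫_ℂ ≠ 0 →
              ∃ (Γ : Level V) (ω : Fin 4 → U.CohC (U.pms F ι₁ V Γ) 1),
                (∀ i, ω i ∈ U.Uiso Γ F (f.psi i) ι₁) ∧
                  ⟪embOf exists_isReal_hodgeModel_holds hodgePQ_independent_of_hodgeModel_holds hU cmAbelianVarietyRealised_holds Γ
                      (U.cup2C (U.pms F ι₁ V Γ) 1 (ω 2) (ω 3)),
                    embOf exists_isReal_hodgeModel_holds hodgePQ_independent_of_hodgeModel_holds hU cmAbelianVarietyRealised_holds Γ
                      (U.cup2C (U.pms F ι₁ V Γ) 1 (ω 0) (ω 1))⟫_ℂ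
                    ≠ 0)) →
    HC_CM :=
  fun hM ↦ hc_cm_of_supply_of_settingMeetSat_embOf exists_isReal_hodgeModel_holds hodgePQ_independent_of_hodgeModel_holds
    BallQuotient.ballQuotientUniformised_holds cmAbelianVarietyRealised_holds deligneMilne1982_Thm_6_20_full_holds
    (faceSupply_of_homNeZero_along_conj_holds_restOne_epi _ _ _ _ h hHom h21) hM

end MeetingFormHomNeZero

end Summit.HodgeConjecture.CorCM.Model

end
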